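import Summits.CriticalPhenomena.Ising3DConformalLimit.Theorems.HyperoctahedralRPExistsScaleCovariantLimitDecimationDefs
import Literature.Probability.LatticeModels.SusceptibilityMeanFieldBound
import Literature.Probability.LatticeModels.CriticalCorrWellDefined
import Literature.Probability.LatticeModels.SharpnessProofs
import Literature.Probability.LatticeModels.RegularScales
import Literature.Probability.LatticeModels.CriticalTwoPointBounds
import Literature.Probability.LatticeModels.GKSInequalities
import Literature.Probability.LatticeModels.HighDimTrivialityUniformProofs
import Summits.CriticalPhenomena.Ising3DConformalLimit.Theorems.PrecisionLaplacianEtaBoundsTransferPackage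
import Mathlib.Analysis.SpecificLimits.Basic
import HarnessLib

/-!
# Curve endpoints `J_χ(0) = β_c(3)`, `J_χ(β_c(3)) = 0` (line `decimation-homotopy-rate` of crux
`ExistsScaleCovariantLimit`, stmt-CriticalPhenomena-1981; stub `stub_curveEndpoints`, C)

`Sig.stub_curveEndpoints : (∀ p ≥ 2, EndpointIdentity p) → BoxBridge → ∀ p ≥ 2, CurveEndpoints p`, where
`CurveEndpoints p := Jcrit p 0 = criticalBeta 3 ∧ Jcrit p (criticalBeta 3) = 0` and
`Jcrit p K = sInf {J ≥ 0 | x ↦ ⟨σ₀σ_{px}⟩_{K,J} not summable}` is the susceptibility-critical curve of the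
two-coupling (nearest-neighbour `K` + sublattice range-`p` `J`) ferromagnet of the Defs module.

* `K = 0` END (`curveEndpoints_subPair_zero_K`): by the endpoint identity and the box bridge, the finite-volume
  sublattice pair function in `Λ_N` is the free n.n. two-point function `⟨σ₀σ_x⟩^∅_{Λ_{⌊N/p⌋};J}` of the
  coarse lattice, which converges (`tendsto_isingTwoPoint_free`, `⌊N/p⌋ → ∞`) to `twoPointFree 3 J x`; and
  for `J ≥ 0`, `twoPointFree 3 J` is summable iff `J < β_c` (`curveEndpoints_summable_twoPointFree_iff`:
  sharpness, `susceptibility_lt_top_of_lt_criticalBeta` / `susceptibility_eq_top_of_criticalBeta_le`).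
  Hence `β_c` is the LEAST element of the defining set and `Jcrit p 0 = β_c`.
* `J = 0` END (`curveEndpoints_subPair_criticalBeta_zero`): at `(K,J) = (β_c,0)` the model is the n.n. model
  at `β_c` (`boxAvg_zero_J`), whose free box correlations converge to the critical state
  (`criticalCorr_wellDefined_holds`, free = plus at `β_c`), so the sublattice pair function is
  `x ↦ criticalTwoPoint 3 (p • x)`; the Simon–Lieb lower bound `c‖y‖^{-2} ≤ criticalTwoPoint 3 y`
  (`criticalTwoPoint_bounds_holds`) summed over the shells `∂Λ_{k+1}` (`≥ 24(k+1)²` sites,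
  `card_sphere_three_ge` of `Theorems.EtaBoundsTransfer`; `‖p•x‖ ≤ p(k+1)`)
  gives shell sums `≥ 24c/p²`, so it is NOT summable (`curveEndpoints_not_summable_criticalTwoPoint_smul`);
  `0` is then the least element of the defining set (which lies in `[0,∞)`) and `Jcrit p β_c = 0`.

References: Friedli–Velenik 2017 §3.7 (sharpness of the n.n. model, `β_c`, susceptibility);
Aizenman–Duminil-Copin–Sidoravicius 2015 (the critical state is well defined); Simon 1980 / Lieb 1980 (lower
bound). All inputs are tree theorems; no definitions are introduced.
-/

noncomputable section

namespace Summit.CriticalPhenomena.Ising3DConformalLimit.Cruxes.ExistsScaleCovariantLimit.DecimationHomotopyRate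

open Literature.Probability.LatticeModels Filter Set Finset
open scoped Topology BigOperators ENNReal
open Summit.CriticalPhenomena.Ising3DConformalLimit.Theorems.EtaBoundsTransfer (card_sphere_three_ge)

/-! ### Small bookkeeping facts -/

/-- `(0, p x) = p • (0, x)` as `2`-configurations. [folklore] -/
theorem curveEndpoints_cfg_smul (p : ℕ) (x : Site 3) :
    (![0, (p : ℤ) • x] : Fin 2 → Site 3) = fun i => (p : ℤ) • (![0, x] : Fin 2 → Site 3) i := by
  funext i
  fin_cases i <;> simp

/-- The spin monomial of the pair configuration `(0, x)` is the pair product `σ₀ σ_x`. [folklore] -/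
theorem curveEndpoints_spinMonomial_pair (x : Site 3) :
    spinMonomial (![0, x] : Fin 2 → Site 3) = spinPair 0 x := by
  funext s
  simp [spinMonomial, spinPair, Fin.prod_univ_two]

/-- Both sites of `(0, x)` lie in `Λ_L` once `x` does. [folklore] -/
theorem curveEndpoints_pair_mem_box {x : Site 3} {L : ℕ} (hx : x ∈ box 3 L) :
    ∀ i, (![0, x] : Fin 2 → Site 3) i ∈ box 3 L := by
  intro i
  fin_cases i
  · exact zero_mem_box 3 L
  · exact hx

/-- `‖p • x‖_∞ ≤ p ‖x‖_∞` on `ℤ³`. [folklore] -/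
theorem curveEndpoints_supNorm_smul_le (p : ℕ) (x : Site 3) :
    Site.supNorm ((p : ℤ) • x) ≤ p * Site.supNorm x := by
  rw [Site.supNorm_le_iff]
  intro i
  rw [Pi.smul_apply, smul_eq_mul, Int.natAbs_mul, Int.natAbs_natCast]
  exact Nat.mul_le_mul_left p (Site.natAbs_le_supNorm x i)

/-! ### The `K = 0` end: the sublattice pair function is the free n.n. two-point function -/

/-- At `K = 0` the sublattice pair function of the period-`p` model (`p ≥ 2`) at coupling `J ≥ 0` is the free
nearest-neighbour two-point function `⟨σ₀σ_x⟩^∅_J` of `ℤ³` (endpoint identity + box bridge + the free-state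
box limit along `⌊N/p⌋ → ∞`). [folklore] -/
theorem curveEndpoints_subPair_zero_K (hE : ∀ p : ℕ, 2 ≤ p → EndpointIdentity p) (hB : BoxBridge)
    {p : ℕ} (hp : 2 ≤ p) {J : ℝ} (hJ : 0 ≤ J) : subPair p 0 J = twoPointFree 3 J := by
  funext x
  unfold subPair
  have hdiv : Tendsto (fun N : ℕ => N / p) atTop atTop := Nat.tendsto_div_const_atTop (by omega)
  have hlim : Tendsto (fun N : ℕ => isingTwoPoint (zdGraph 3) (box 3 (N / p)) J 0 .free 0 x) atTop
      (𝓝 (twoPointFree 3 J x)) :=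
    (tendsto_isingTwoPoint_free hasBoxLimit_isingCorr_free_holds hJ x).comp hdiv
  refine (hlim.congr' ?_).limUnder_eq
  filter_upwards [hdiv.eventually (eventually_mem_box x)] with N hN
  rw [curveEndpoints_cfg_smul p x, hE p hp N J 2 ![0, x],
    hB (N / p) J 2 ![0, x] (curveEndpoints_pair_mem_box hN), curveEndpoints_spinMonomial_pair]
  rfl

/-- Sharpness of the n.n. model on `ℤ³` in summability form: for `J ≥ 0`, `x ↦ ⟨σ₀σ_x⟩^∅_J` is summable iff
`J < β_c(3)` (`χ(J) < ∞` below `β_c`, `χ(J) = ∞` from `β_c` on). [folklore] -/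
theorem curveEndpoints_summable_twoPointFree_iff {J : ℝ} (hJ : 0 ≤ J) :
    Summable (twoPointFree 3 J) ↔ J < criticalBeta 3 := by
  have hnn : ∀ x, 0 ≤ twoPointFree 3 J x := fun x => twoPointFree_nonneg_of_nonneg hJ x
  constructor
  · intro hs
    by_contra hle
    have htop := susceptibility_eq_top_of_criticalBeta_le (d := 3) (by norm_num) (not_lt.1 hle)
    unfold susceptibility at htop
    rw [← ENNReal.ofReal_tsum_of_nonneg hnn hs] at htop
    exact ENNReal.ofReal_ne_top htop
  · intro hJc
    have hlt := susceptibility_lt_top_of_lt_criticalBeta (d := 3) (by norm_num) hJ hJc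
    unfold susceptibility at hlt
    have hs : Summable fun x => (ENNReal.ofReal (twoPointFree 3 J x)).toReal :=
      ENNReal.summable_toReal hlt.ne
    exact hs.congr fun x => ENNReal.toReal_ofReal (hnn x)

/-- **`J_χ(0) = β_c(3)`** for every period `p ≥ 2`, given the endpoint identity and the box bridge. [folklore] -/
theorem curveEndpoints_Jcrit_zero (hE : ∀ p : ℕ, 2 ≤ p → EndpointIdentity p) (hB : BoxBridge)
    {p : ℕ} (hp : 2 ≤ p) : Jcrit p 0 = criticalBeta 3 := by
  unfold Jcrit
  have hls : IsLeast {J : ℝ | 0 ≤ J ∧ ¬ Summable (subPair p 0 J)} (criticalBeta 3) := by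
    refine ⟨⟨criticalBeta_nonneg 3, ?_⟩, ?_⟩
    · rw [curveEndpoints_subPair_zero_K hE hB hp (criticalBeta_nonneg 3),
        curveEndpoints_summable_twoPointFree_iff (criticalBeta_nonneg 3)]
      exact lt_irrefl _
    · rintro J ⟨hJ, hns⟩
      rw [curveEndpoints_subPair_zero_K hE hB hp hJ, curveEndpoints_summable_twoPointFree_iff hJ,
        not_lt] at hns
      exact hns
  exact hls.csInf_eq

/-! ### The `J = 0` end: the sublattice pair function at `β_c` is not summable -/

/-- At `(K, J) = (β_c, 0)` the sublattice pair function is the critical two-point function on the sublattice,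
`x ↦ ⟨σ₀σ_{px}⟩⁺_{β_c}` (the model is the n.n. model at `β_c`; its free box correlations converge to the
critical state, `criticalCorr_wellDefined_holds`). [folklore] -/
theorem curveEndpoints_subPair_criticalBeta_zero (hB : BoxBridge) (p : ℕ) (x : Site 3) :
    subPair p (criticalBeta 3) 0 x = criticalTwoPoint 3 ((p : ℤ) • x) := by
  unfold subPair
  have hlim : Tendsto (fun N : ℕ => isingExpect (zdGraph 3) (box 3 N) (criticalBeta 3) 0 .free
      (spinMonomial (![0, (p : ℤ) • x] : Fin 2 → Site 3))) atTop
      (𝓝 (criticalTwoPoint 3 ((p : ℤ) • x))) := by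
    rw [← criticalCorr_two]
    exact criticalCorr_wellDefined_holds (d := 3) le_rfl 2 _ .free (by simp)
  refine (hlim.congr' ?_).limUnder_eq
  filter_upwards [eventually_mem_box ((p : ℤ) • x)] with N hN
  rw [boxAvg_zero_J, hB N (criticalBeta 3) 2 _ (curveEndpoints_pair_mem_box hN)]

/-- The critical two-point function restricted to the sublattice `pℤ³` (`p ≥ 1`) is not summable: by the
Simon–Lieb lower bound `⟨σ₀σ_y⟩_{β_c} ≥ c‖y‖^{-2}` and `‖p x‖ ≤ p(k+1)` on the shell `∂Λ_{k+1}`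
(`≥ 24(k+1)²` sites) every shell contributes `≥ 24c/p²`, so the box sums grow linearly. [folklore] -/
theorem curveEndpoints_not_summable_criticalTwoPoint_smul {p : ℕ} (hp : 1 ≤ p) :
    ¬ Summable (fun x : Site 3 => criticalTwoPoint 3 ((p : ℤ) • x)) := by
  obtain ⟨c₀, C₀, hc₀, hbd⟩ := criticalTwoPoint_bounds_holds (d := 3) (by norm_num)
  have hnn : ∀ y, 0 ≤ criticalTwoPoint 3 y := fun y =>
    twoPointPlus_nonneg_of_gks (criticalBeta_nonneg 3) y
  have hp0 : (0 : ℝ) < p := by exact_mod_cast hp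
  intro hs
  -- shell lower bound: `∑_{x ∈ ∂Λ_{k+1}} G(p x) ≥ 24 c₀ / p²`
  have hshell : ∀ k : ℕ, 24 * c₀ / (p : ℝ) ^ 2 ≤
      ∑ x ∈ sphere 3 (k + 1), criticalTwoPoint 3 ((p : ℤ) • x) := by
    intro k
    have hm : (0 : ℝ) < (p : ℝ) * ((k : ℝ) + 1) := by positivity
    have hterm : ∀ x ∈ sphere 3 (k + 1),
        c₀ * ((p : ℝ) * ((k : ℝ) + 1)) ^ (-(2 : ℝ)) ≤ criticalTwoPoint 3 ((p : ℤ) • x) := by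
      intro x hx
      have hsn : Site.supNorm x = k + 1 := mem_sphere.1 hx
      have hx0 : x ≠ 0 := by
        intro h
        rw [h, Site.supNorm_eq_zero_iff.2 rfl] at hsn
        omega
      have hpz : (p : ℤ) ≠ 0 := by exact_mod_cast (show p ≠ 0 by omega)
      have hy0 : (p : ℤ) • x ≠ 0 := smul_ne_zero hpz hx0
      have hlow := (hbd _ hy0).1
      rw [show -(((3 : ℕ) : ℝ) - 1) = -2 by norm_num] at hlow
      have hnorm_pos : 0 < ‖(p : ℤ) • x‖ := norm_pos_iff.2 hy0
      have hnorm_le : ‖(p : ℤ) • x‖ ≤ (p : ℝ) * ((k : ℝ) + 1) := by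
        rw [Site.norm_eq_supNorm]
        have h := curveEndpoints_supNorm_smul_le p x
        rw [hsn] at h
        exact_mod_cast h
      calc c₀ * ((p : ℝ) * ((k : ℝ) + 1)) ^ (-(2 : ℝ))
          ≤ c₀ * ‖(p : ℤ) • x‖ ^ (-(2 : ℝ)) :=
            mul_le_mul_of_nonneg_left
              (Real.rpow_le_rpow_of_nonpos hnorm_pos hnorm_le (by norm_num)) hc₀.le
        _ ≤ criticalTwoPoint 3 ((p : ℤ) • x) := hlow
    calc 24 * c₀ / (p : ℝ) ^ 2
        = (24 * ((k : ℝ) + 1) ^ 2) * (c₀ * ((p : ℝ) * ((k : ℝ) + 1)) ^ (-(2 : ℝ))) := by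
          rw [Real.rpow_neg hm.le, Real.rpow_two]
          field_simp
      _ ≤ (#(sphere 3 (k + 1)) : ℝ) * (c₀ * ((p : ℝ) * ((k : ℝ) + 1)) ^ (-(2 : ℝ))) :=
          mul_le_mul_of_nonneg_right (card_sphere_three_ge k) (by positivity)
      _ = ∑ _x ∈ sphere 3 (k + 1), c₀ * ((p : ℝ) * ((k : ℝ) + 1)) ^ (-(2 : ℝ)) := by
          rw [Finset.sum_const, nsmul_eq_mul]
      _ ≤ ∑ x ∈ sphere 3 (k + 1), criticalTwoPoint 3 ((p : ℤ) • x) := Finset.sum_le_sum hterm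
  -- box sums grow linearly
  have hbox : ∀ n : ℕ, 24 * c₀ / (p : ℝ) ^ 2 * n ≤
      ∑ x ∈ box 3 n, criticalTwoPoint 3 ((p : ℤ) • x) := by
    intro n
    rw [sum_box_eq_sum_sphere (fun x : Site 3 => criticalTwoPoint 3 ((p : ℤ) • x)),
      Finset.sum_range_succ']
    have h0 : 0 ≤ ∑ x ∈ sphere 3 0, criticalTwoPoint 3 ((p : ℤ) • x) :=
      Finset.sum_nonneg fun x _ => hnn _
    have h1 : ∑ _k ∈ Finset.range n, (24 * c₀ / (p : ℝ) ^ 2) ≤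
        ∑ k ∈ Finset.range n, ∑ x ∈ sphere 3 (k + 1), criticalTwoPoint 3 ((p : ℤ) • x) :=
      Finset.sum_le_sum fun k _ => hshell k
    rw [Finset.sum_const, Finset.card_range, nsmul_eq_mul] at h1
    linarith
  -- contradiction with summability
  have hA : (0 : ℝ) < 24 * c₀ / (p : ℝ) ^ 2 := by positivity
  set S := ∑' x, criticalTwoPoint 3 ((p : ℤ) • x) with hS
  obtain ⟨n, hn⟩ := exists_nat_gt (S / (24 * c₀ / (p : ℝ) ^ 2))
  have h1 : ∑ x ∈ box 3 n, criticalTwoPoint 3 ((p : ℤ) • x) ≤ S :=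
    hs.sum_le_tsum _ fun x _ => hnn _
  have h2 : S < 24 * c₀ / (p : ℝ) ^ 2 * n := by rwa [div_lt_iff₀ hA, mul_comm] at hn
  linarith [hbox n]

/-- **`J_χ(β_c(3)) = 0`** for every period `p ≥ 1`, given the box bridge: `0` lies in the defining set
(the sublattice critical two-point function is not summable) and the set lies in `[0, ∞)`. [folklore] -/
theorem curveEndpoints_Jcrit_criticalBeta (hB : BoxBridge) {p : ℕ} (hp : 1 ≤ p) :
    Jcrit p (criticalBeta 3) = 0 := by
  unfold Jcrit
  have hls : IsLeast {J : ℝ | 0 ≤ J ∧ ¬ Summable (subPair p (criticalBeta 3) J)} 0 := by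
    refine ⟨⟨le_rfl, ?_⟩, fun J hJ => hJ.1⟩
    have h : subPair p (criticalBeta 3) 0 = fun x => criticalTwoPoint 3 ((p : ℤ) • x) :=
      funext fun x => curveEndpoints_subPair_criticalBeta_zero hB p x
    rw [h]
    exact curveEndpoints_not_summable_criticalTwoPoint_smul hp
  exact hls.csInf_eq

/-! ### The stub -/

/-- **Stub C — curve endpoints.** Given the endpoint identity (all `p ≥ 2`, all volumes) and the box bridge,
the susceptibility-critical curve of the period-`p` two-coupling family joins `(K, J) = (0, β_c(3))` to
`(β_c(3), 0)`: `Jcrit p 0 = criticalBeta 3` (sharpness of the coarse n.n. model) and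
`Jcrit p (criticalBeta 3) = 0` (the sublattice critical two-point function is not summable, Simon–Lieb).
[folklore] -/
theorem stub_curveEndpoints : Sig.stub_curveEndpoints := by
  intro hE hB p hp
  exact ⟨curveEndpoints_Jcrit_zero hE hB hp, curveEndpoints_Jcrit_criticalBeta hB (by omega)⟩

end Summit.CriticalPhenomena.Ising3DConformalLimit.Cruxes.ExistsScaleCovariantLimit.DecimationHomotopyRate

end
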